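import Summits.HodgeConjecture.HodgeConjecture.Theorems.TwistedCyclotomicSelfMapSquareHodgeSemilinear

/-!
# TWIST-SEP, II — Level 1 PROVED: `twistSepEndSpan_holds` (Hodge step, twisted averaging operators, assembly)

Part 2 of 3 (Sketch §A′ steps (4)–(6), ll. 300–613): (4) KEY HODGE STEP `deg_mul_eq_of_semiconj` — an injective `t`-semilinear Hodge
endomorphism forces `t ∈ W`; (5) the twisted averaging operators `Ψ_t(g) = Σ_k α^{-tk} g α^k` (`semiconj_twistAverage`, `sum_twistAverage`:
`Σ_t Ψ_t(g) = N g`, a character-sum computation on the eigenbasis); (6) assembly `coe_endAlg_mem_span_of_twists` and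
**`twistSepEndSpan_holds : TwistSepEndSpan`** — `End_Hdg(H) ⊆ span_ℚ ({aⁱ} ∪ {aⁱ ∘ p_k})` as soon as Hodge endomorphisms `p_k` realising every
`w ∈ W ∖ {1}` are supplied. CYC-SEP (tree `coe_endAlg_mem_span_pow_of_separated`) is the case `W = 1`.

PROVENANCE. Cell hodge-nonav (HUMAN RULING D-0038), planner seat p1 g32: chapter ROUTE-P1AE §A (memo `HOME/memos/ROUTE-P1AE.md`),
frozen Sketch `HOME/p1/route/Sketch_P1AE_GRPSEP_g32.lean` (sha16 38cae48bc3bf4f6b, 1242 lines, namespace `HodgeNonAV.P1AE`, farm rc 0 /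
0 sorries / axioms {propext, Classical.choice, Quot.sound}; referee PASS: ref g50, REF-P1AE.md 05a6fdcdc7be5ad5), §A/§A′/§A″ split into three
tree modules `TwistedCyclotomicSelfMapSquareHodgeSemilinear` → `…Abstract` → `TwistedCyclotomicSelfMapSquareHodge` by planner p1 g34 (landing
kit HOME/p1/landing/, 2026-08-28); bodies verbatim (§B of the Sketch is superseded by `Theorems/FermatSurfaceSeparation*` and omitted).
Extends the K6-landed `Theorems/SeparatedCyclotomicSelfMapSquareHodge{Abstract,}` (p576675 ∕ p577238: CYC-SEP = the case `W = 1`).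
Land with `--supports stmt-HodgeConjecture-19652 --as helper`. No instance, no new notation (four `local notation3` of Part 3 are the
tree's, verbatim from `Theorems/SeparatedCyclotomicSelfMapSquareHodge`), no sorry, no new axiom.
HONEST SCOPE: `HC⁴(S × S)` for surfaces `S` with `p_g = 1`-type cyclotomic self-maps whose type table has a non-trivial stabiliser `W`,
GIVEN further self-maps realising the twists — all such `S × S` known to us are dominated by products of curves ∕ Fermat quotients, so this is a
re-proof engine inside the known region; NOTHING here proves the Hodge conjecture.
References: Green–Griffiths–Kerr, *Mumford–Tate groups and domains* (2012) §V.C [cite: GreenGriffithsKerr2012, §V.C]; T. Shioda, Math. Ann.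
245 (1979) Thm II, IV [cite: Shioda1979, Thm. II]; D. Huybrechts, *Lectures on K3 surfaces* (2016) Ch. 3 [cite: Huybrechts2016K3, Ch. 3];
C. Voisin, *Hodge theory I* (2002) §11 [cite: VoisinHodgeI2002, Thm. 11.41].
-/

set_option linter.dupNamespace false

noncomputable section

namespace Summit.HodgeConjecture.HodgeConjecture.Theorems.TwistedCyclotomicSelfMapSquareHodge

open scoped TensorProduct
open CategoryTheory MonoidalCategory
open Literature.AlgebraicGeometry Literature.AlgebraicGeometry.Motives Literature.AlgebraicGeometry.HodgeTheory
open Literature.AlgebraicTopology.SingularHomology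
open Literature.AlgebraicGeometry.Motives.HodgeStructure Literature.AlgebraicGeometry.Surfaces
open Summit.HodgeConjecture.HodgeConjecture.Theorems.PgOneCyclotomicSquares
open Summit.HodgeConjecture.HodgeConjecture.Theorems.SeparatedCyclotomicSelfMapSquareHodge
open Polynomial

section TwistSepProof

namespace TwistSep

universe u

variable {V : Type u} [AddCommGroup V] [Module ℚ V]

/-! ### (4) the twist type of an injective semilinear HODGE endomorphism stabilises the type table -/

/-- Base change preserves injectivity of an endomorphism of a finite-dimensional space (via a left inverse). [folklore] -/
theorem baseChange_injective_of_injective [Module.Finite ℚ V] {h : Module.End ℚ V} (hinj : Function.Injective h) :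
    Function.Injective (h.baseChange ℂ) := by
  set ps : Module.End ℚ V := ((LinearEquiv.ofInjectiveEndo h hinj).symm : V →ₗ[ℚ] V) with hpsdef
  have hleft : ps * h = 1 := LinearEquiv.ofInjectiveEndo_left_inv h hinj
  intro x y hxy
  have h2 := congrArg (ps.baseChange ℂ) hxy
  rwa [← Module.End.mul_apply, ← Module.End.mul_apply, ← LinearMap.baseChange_mul, hleft, LinearMap.baseChange_one,
    Module.End.one_apply, Module.End.one_apply] at h2

/-- Powers act on the eigenbasis by powers of the eigenvalue. [folklore] -/
theorem baseChange_pow_apply_eigen {α : Module.End ℚ V} {N : ℕ} {ζ : ℂ} {ω : (ZMod N)ˣ → ℂ ⊗[ℚ] V}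
    (heig : ∀ u, α.baseChange ℂ (ω u) = ζ ^ (u : ZMod N).val • ω u) (k : ℕ) (u : (ZMod N)ˣ) :
    (α ^ k).baseChange ℂ (ω u) = (ζ ^ (u : ZMod N).val) ^ k • ω u := by
  induction k with
  | zero => rw [pow_zero, LinearMap.baseChange_one, Module.End.one_apply, pow_zero, one_smul]
  | succ k ih => rw [pow_succ, LinearMap.baseChange_mul, Module.End.mul_apply, heig, map_smul, ih, smul_smul, ← pow_succ']

/-- Finite sums commute with base change. [folklore] -/
theorem baseChange_finset_sum {ι : Type*} (s : Finset ι) (F : ι → Module.End ℚ V) :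
    (∑ i ∈ s, F i).baseChange ℂ = ∑ i ∈ s, (F i).baseChange ℂ := by
  classical
  induction s using Finset.induction_on with
  | empty => rw [Finset.sum_empty, Finset.sum_empty, LinearMap.baseChange_zero]
  | insert a s ha ih => rw [Finset.sum_insert ha, Finset.sum_insert ha, LinearMap.baseChange_add, ih]

/-- **Key Hodge-theoretic step.** An injective `h ∈ End_Hdg(H)` with `h α = α^t h` maps the eigenline `ℂ ω_{tu}` isomorphically
onto `ℂ ω_u` inside `F^{deg (tu)}`; hence `deg (tu) ≤ deg u` for all `u`, and by finiteness of the order of `t`, `deg (tu) = deg u`: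
the twist type `t` stabilises the type table. [folklore] -/
theorem deg_mul_eq_of_semiconj [Module.Finite ℚ V] {n : ℤ} {H : HodgeStructure V n} {α : Module.End ℚ V} {N : ℕ}
    (hN : 0 < N) {ζ : ℂ} (hζ : IsPrimitiveRoot ζ N) (deg : (ZMod N)ˣ → ℤ) (ω : (ZMod N)ˣ → ℂ ⊗[ℚ] V)
    (hω0 : ∀ u, ω u ≠ 0) (hF : ∀ u, ω u ∈ H.F (deg u)) (hnF : ∀ u, ω u ∉ H.F (deg u + 1))
    (heig : ∀ u, α.baseChange ℂ (ω u) = ζ ^ (u : ZMod N).val • ω u) (hrk : Module.finrank ℚ V = Nat.totient N)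
    {h : Module.End ℚ V} (hh : h ∈ H.endAlg) {t : (ZMod N)ˣ} (hs : SemiconjBy h α (α ^ (t : ZMod N).val))
    (hinj : Function.Injective h) (u : (ZMod N)ˣ) : deg (t * u) = deg u := by
  haveI : NeZero N := ⟨hN.ne'⟩
  have hμ : Function.Injective fun u : (ZMod N)ˣ ↦ ζ ^ (u : ZMod N).val := pow_val_injective hζ
  have hev : ∀ u : (ZMod N)ˣ, Module.End.HasEigenvector (α.baseChange ℂ) (ζ ^ (u : ZMod N).val) (ω u) := fun u ↦
    ⟨Module.End.mem_eigenspace_iff.2 (heig u), hω0 u⟩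
  have hli : LinearIndependent ℂ ω := Module.End.eigenvectors_linearIndependent' _ _ hμ ω hev
  have hcard : Fintype.card (ZMod N)ˣ = Module.finrank ℂ (ℂ ⊗[ℚ] V) := by
    rw [ZMod.card_units_eq_totient, Module.finrank_baseChange, hrk]
  have hspan : Submodule.span ℂ (Set.range ω) = ⊤ := hli.span_eq_top_of_card_eq_finrank' hcard
  -- `(α^t)_ℂ` is diagonal on `ω` with the simple spectrum `w ↦ ζ^{tw}`
  have hTω : ∀ w, (α ^ (t : ZMod N).val).baseChange ℂ (ω w) = ζ ^ ((t * w : (ZMod N)ˣ) : ZMod N).val • ω w :=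
    fun w ↦ by rw [baseChange_pow_apply_eigen heig, ← pow_val_mul hζ w t, mul_comm w t]
  have hμ' : Function.Injective fun w : (ZMod N)ˣ ↦ ζ ^ ((t * w : (ZMod N)ˣ) : ZMod N).val :=
    fun w w' hww' ↦ mul_left_cancel (hμ hww')
  have hinjC := baseChange_injective_of_injective hinj
  -- `deg (t v) ≤ deg v` for every `v`
  have hle : ∀ v, deg (t * v) ≤ deg v := by
    intro v
    have hx : (α ^ (t : ZMod N).val).baseChange ℂ (h.baseChange ℂ (ω (t * v))) =
        ζ ^ ((t * v : (ZMod N)ˣ) : ZMod N).val • h.baseChange ℂ (ω (t * v)) := by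
      rw [← Module.End.mul_apply, ← LinearMap.baseChange_mul, ← hs.eq, LinearMap.baseChange_mul, Module.End.mul_apply,
        heig, map_smul]
    obtain ⟨c, hc⟩ := exists_eq_smul_of_eigen hli hspan hμ' hTω v hx
    have hc0 : c ≠ 0 := by
      rintro rfl
      rw [zero_smul] at hc
      exact hω0 _ (hinjC (by rw [hc, map_zero]))
    have hmem : h.baseChange ℂ (ω (t * v)) ∈ H.F (deg (t * v)) := (mem_endAlg_iff H h).1 hh _ ⟨ω (t * v), hF _, rfl⟩
    rw [hc, Submodule.smul_mem_iff _ hc0] at hmem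
    by_contra hlt
    rw [not_le] at hlt
    exact hnF v (H.antitone_F (show deg v + 1 ≤ deg (t * v) by omega) hmem)
  -- periodicity of `k ↦ deg (t^k v)` forces equality
  have hiter : ∀ k v, deg (t ^ (k + 1) * v) ≤ deg (t * v) := by
    intro k
    induction k with
    | zero => intro v; rw [zero_add, pow_one]
    | succ k ih =>
      intro v
      calc deg (t ^ (k + 1 + 1) * v) = deg (t * (t ^ (k + 1) * v)) := by rw [pow_succ', mul_assoc]
        _ ≤ deg (t ^ (k + 1) * v) := hle _
        _ ≤ deg (t * v) := ih v
  obtain ⟨k, hk⟩ := Nat.exists_eq_succ_of_ne_zero (orderOf_pos t).ne'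
  have h1 : deg u ≤ deg (t * u) := by
    have := hiter k u
    rw [show k + 1 = orderOf t by rw [hk]] at this
    rwa [pow_orderOf_eq_one, one_mul] at this
  exact le_antisymm (hle u) h1

/-! ### (5) the twisted averaging operators -/

/-- `ζ^a` only depends on `a mod N`. [folklore] -/
theorem zpow_mod_eq {N : ℕ} {ζ : ℂ} (hζ : IsPrimitiveRoot ζ N) {a b : ℕ} (h : a % N = b % N) : ζ ^ a = ζ ^ b := by
  rw [← Nat.mod_add_div a N, ← Nat.mod_add_div b N, pow_add, pow_add, pow_mul, pow_mul, hζ.pow_eq_one, one_pow, one_pow,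
    h]

/-- A cyclic shift does not change a sum over a full period. [folklore] -/
theorem sum_range_shift {M : Type*} [AddCommGroup M] (f : ℕ → M) (N : ℕ) (h : f N = f 0) :
    ∑ k ∈ Finset.range N, f (k + 1) = ∑ k ∈ Finset.range N, f k := by
  have h1 := Finset.sum_range_succ' f N
  have h2 := Finset.sum_range_succ f N
  rw [h2, h] at h1
  exact (add_right_cancel h1).symm

/-- The twisted average `Ψ_t(g) = Σ_k α^{-tk} g α^k` is `t`-semilinear: `Ψ_t(g) α = α^t Ψ_t(g)`. [folklore] -/
theorem semiconj_twistAverage {α : Module.End ℚ V} (g : Module.End ℚ V) {N : ℕ} [NeZero N] (hαN : α ^ N = 1)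
    (t : (ZMod N)ˣ) :
    SemiconjBy (∑ k ∈ Finset.range N, α ^ ((-(t : ZMod N) * (k : ZMod N)).val) * g * α ^ k) α
      (α ^ (t : ZMod N).val) := by
  set f : ℕ → Module.End ℚ V := fun k ↦ α ^ ((-(t : ZMod N) * (k : ZMod N)).val) * g * α ^ k with hf
  have key : ∀ k : ℕ, α ^ ((-(t : ZMod N) * (k : ZMod N)).val) =
      α ^ (t : ZMod N).val * α ^ ((-(t : ZMod N) * ((k + 1 : ℕ) : ZMod N)).val) := by
    intro k
    have hz : -(t : ZMod N) * (k : ZMod N) = (t : ZMod N) + -(t : ZMod N) * ((k + 1 : ℕ) : ZMod N) := by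
      push_cast; ring
    rw [hz, ZMod.val_add, ← pow_eq_pow_mod hαN, pow_add]
  have hfN : f N = f 0 := by
    simp only [hf, ZMod.natCast_self, Nat.cast_zero, hαN, pow_zero]
  show (∑ k ∈ Finset.range N, f k) * α = α ^ (t : ZMod N).val * ∑ k ∈ Finset.range N, f k
  rw [Finset.sum_mul, ← sum_range_shift f N hfN, Finset.mul_sum]
  refine Finset.sum_congr rfl fun k _ ↦ ?_
  simp only [hf]
  rw [key k, mul_assoc, mul_assoc, mul_assoc, mul_assoc, ← pow_succ]

/-- `Σ_{t ∈ (ℤ/N)ˣ} Ψ_t(g) = N·g` — a character-sum computation on the eigenbasis. [folklore] -/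
theorem sum_twistAverage {α : Module.End ℚ V} (g : Module.End ℚ V) {N : ℕ} [NeZero N] {ζ : ℂ}
    (hζ : IsPrimitiveRoot ζ N) (ω : (ZMod N)ˣ → ℂ ⊗[ℚ] V) (hspan : Submodule.span ℂ (Set.range ω) = ⊤)
    (heig : ∀ u, α.baseChange ℂ (ω u) = ζ ^ (u : ZMod N).val • ω u) :
    ∑ t : (ZMod N)ˣ, ∑ k ∈ Finset.range N, α ^ ((-(t : ZMod N) * (k : ZMod N)).val) * g * α ^ k = (N : ℚ) • g := by
  -- exponent bookkeeping mod N
  have hmod : ∀ a b : ℕ, (a : ZMod N) = (b : ZMod N) → ζ ^ a = ζ ^ b :=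
    fun a b h ↦ zpow_mod_eq hζ ((ZMod.natCast_eq_natCast_iff' a b N).1 h)
  -- (i) `R_k := Σ_t α^{-tk}` acts on `V_ℂ` as the scalar `ρ k`
  set ρ : ℕ → ℂ := fun k ↦ ∑ t : (ZMod N)ˣ, ζ ^ ((-(t : ZMod N) * (k : ZMod N)).val) with hρ
  have hRω : ∀ (k : ℕ) (w : (ZMod N)ˣ),
      (∑ t : (ZMod N)ˣ, α ^ ((-(t : ZMod N) * (k : ZMod N)).val)).baseChange ℂ (ω w) = ρ k • ω w := by
    intro k w
    rw [baseChange_finset_sum, LinearMap.sum_apply]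
    simp_rw [baseChange_pow_apply_eigen heig]
    rw [← Finset.sum_smul]
    congr 1
    -- `Σ_t (ζ^w)^{(-t k).val} = Σ_t ζ^{(-(w t) k).val} = ρ k`
    have h1 : ∀ t : (ZMod N)ˣ, (ζ ^ (w : ZMod N).val) ^ ((-(t : ZMod N) * (k : ZMod N)).val) =
        ζ ^ ((-((w * t : (ZMod N)ˣ) : ZMod N) * (k : ZMod N)).val) := by
      intro t
      rw [← pow_mul]
      apply hmod
      simp only [Nat.cast_mul, ZMod.natCast_zmod_val, Units.val_mul]
      ring
    simp_rw [h1]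
    exact Fintype.sum_bijective (fun t : (ZMod N)ˣ ↦ w * t) (Group.mulLeft_bijective w) _ _ fun t ↦ rfl
  have hR : ∀ (k : ℕ) (y : ℂ ⊗[ℚ] V),
      (∑ t : (ZMod N)ˣ, α ^ ((-(t : ZMod N) * (k : ZMod N)).val)).baseChange ℂ y = ρ k • y := by
    intro k y
    have hext : (∑ t : (ZMod N)ˣ, α ^ ((-(t : ZMod N) * (k : ZMod N)).val)).baseChange ℂ = ρ k • LinearMap.id := by
      refine LinearMap.ext_on_range hspan fun w ↦ ?_
      rw [hRω, LinearMap.smul_apply, LinearMap.id_apply]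
    rw [hext, LinearMap.smul_apply, LinearMap.id_apply]
  -- (ii) regroup: `Σ_t Σ_k α^{-tk} g α^k = Σ_k R_k g α^k`
  have hregroup : ∑ t : (ZMod N)ˣ, ∑ k ∈ Finset.range N, α ^ ((-(t : ZMod N) * (k : ZMod N)).val) * g * α ^ k =
      ∑ k ∈ Finset.range N, (∑ t : (ZMod N)ˣ, α ^ ((-(t : ZMod N) * (k : ZMod N)).val)) * g * α ^ k := by
    rw [Finset.sum_comm]
    refine Finset.sum_congr rfl fun k _ ↦ ?_
    rw [Finset.sum_mul, Finset.sum_mul]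
  -- (iii) the character sum `Σ_k ρ_k ζ^{vk} = N`
  have hchar : ∀ v : (ZMod N)ˣ, ∑ k ∈ Finset.range N, ρ k * (ζ ^ (v : ZMod N).val) ^ k = (N : ℂ) := by
    intro v
    have hx : ∀ (t : (ZMod N)ˣ) (k : ℕ), ζ ^ ((-(t : ZMod N) * (k : ZMod N)).val) * (ζ ^ (v : ZMod N).val) ^ k =
        (ζ ^ (((v : ZMod N) - (t : ZMod N)).val)) ^ k := by
      intro t k
      rw [← pow_mul, ← pow_mul, ← pow_add]
      apply hmod
      simp only [Nat.cast_mul, Nat.cast_add, ZMod.natCast_zmod_val]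
      ring
    have hgeom : ∀ t : (ZMod N)ˣ, ∑ k ∈ Finset.range N, (ζ ^ (((v : ZMod N) - (t : ZMod N)).val)) ^ k =
        if t = v then (N : ℂ) else 0 := by
      intro t
      by_cases htv : t = v
      · rw [if_pos htv, htv, sub_self, ZMod.val_zero, pow_zero]
        simp
      · rw [if_neg htv]
        have hx1 : ζ ^ (((v : ZMod N) - (t : ZMod N)).val) ≠ 1 := by
          intro h1
          apply htv
          have hdvd := (hζ.pow_eq_one_iff_dvd _).1 h1
          have h0 : (((v : ZMod N) - (t : ZMod N)).val) = 0 := Nat.eq_zero_of_dvd_of_lt hdvd (ZMod.val_lt _)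
          rw [ZMod.val_eq_zero, sub_eq_zero] at h0
          exact (Units.ext h0).symm
        rw [geom_sum_eq hx1, ← pow_mul, mul_comm, pow_mul, hζ.pow_eq_one, one_pow, sub_self, zero_div]
    calc ∑ k ∈ Finset.range N, ρ k * (ζ ^ (v : ZMod N).val) ^ k
        = ∑ k ∈ Finset.range N, ∑ t : (ZMod N)ˣ, (ζ ^ (((v : ZMod N) - (t : ZMod N)).val)) ^ k := by
          refine Finset.sum_congr rfl fun k _ ↦ ?_
          rw [hρ, Finset.sum_mul]
          exact Finset.sum_congr rfl fun t _ ↦ hx t k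
      _ = ∑ t : (ZMod N)ˣ, ∑ k ∈ Finset.range N, (ζ ^ (((v : ZMod N) - (t : ZMod N)).val)) ^ k := Finset.sum_comm
      _ = ∑ t : (ZMod N)ˣ, if t = v then (N : ℂ) else 0 := Finset.sum_congr rfl fun t _ ↦ hgeom t
      _ = (N : ℂ) := by rw [Finset.sum_ite_eq', if_pos (Finset.mem_univ v)]
  -- (iv) compare both sides on the eigenbasis
  rw [hregroup]
  refine sub_eq_zero.1 (eq_zero_of_baseChange_apply_eq_zero ω hspan _ fun v ↦ ?_)
  rw [LinearMap.baseChange_sub, LinearMap.sub_apply, sub_eq_zero, baseChange_finset_sum, LinearMap.sum_apply,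
    LinearMap.baseChange_smul, LinearMap.smul_apply]
  have hterm : ∀ k ∈ Finset.range N,
      ((∑ t : (ZMod N)ˣ, α ^ ((-(t : ZMod N) * (k : ZMod N)).val)) * g * α ^ k).baseChange ℂ (ω v) =
        (ρ k * (ζ ^ (v : ZMod N).val) ^ k) • g.baseChange ℂ (ω v) := by
    intro k _
    rw [LinearMap.baseChange_mul, LinearMap.baseChange_mul, Module.End.mul_apply, Module.End.mul_apply,
      baseChange_pow_apply_eigen heig, map_smul, hR, smul_smul]
  rw [Finset.sum_congr rfl hterm, ← Finset.sum_smul, hchar, Nat.cast_smul_eq_nsmul, Nat.cast_smul_eq_nsmul]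

/-! ### (6) TWIST-SEP, Level 1 -/

/-- **TWIST-SEP (Level 1, linear algebra + Hodge theory).** Hypotheses of the tree's CYC-SEP Level 1
(`coe_endAlg_mem_span_pow_of_separated`) WITHOUT the separation hypothesis; instead: non-zero Hodge endomorphisms `p k`
(`k ∈ K`, finite) with `p_k a = a^{t_k} p_k`, whose twist types `t k` cover the stabiliser
`W = {w : deg (w u) = deg u ∀ u}` up to `w = 1`. CONCLUSION: `End_Hdg(H) = Σ_i ℚ a^i + Σ_{k,i} ℚ a^i p_k`.
PROOF: `V` is a line over the field `ℚ[a] ≅ ℚ(ζ_N)` (`cyclotomicLine`); the twisted averages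
`Ψ_s(g) = Σ_k a^{-sk} g a^k` (`s ∈ (ℤ/N)ˣ`) are `s`-semilinear Hodge endomorphisms with `Σ_s Ψ_s(g) = N g`
(`semiconj_twistAverage`, `sum_twistAverage`); a non-zero `s`-semilinear endomorphism is injective (`injective_of_semiconj`),
an injective `s`-semilinear HODGE endomorphism forces `s ∈ W` (`deg_mul_eq_of_semiconj`), and the `s`-semilinear endomorphisms
form a `ℚ[a]`-line through `p_k` (`exists_eq_aeval_mul`) resp. through `1` (`exists_eq_aeval_of_commute`). [folklore]
[cite: Huybrechts2016K3, Ch. 3 Cor. 3.6 and Thm. 3.7] -/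
theorem coe_endAlg_mem_span_of_twists [Module.Finite ℚ V] {n : ℤ} {H : HodgeStructure V n}
    (a : H.endAlg) {N : ℕ} (hN : 0 < N) {ζ : ℂ} (hζ : IsPrimitiveRoot ζ N)
    (deg : (ZMod N)ˣ → ℤ) (ω : (ZMod N)ˣ → ℂ ⊗[ℚ] V) (hω0 : ∀ u, ω u ≠ 0)
    (hF : ∀ u, ω u ∈ H.F (deg u)) (hnF : ∀ u, ω u ∉ H.F (deg u + 1))
    (heig : ∀ u, ((a : Module.End ℚ V).baseChange ℂ) (ω u) = ζ ^ (u : ZMod N).val • ω u)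
    (hrk : Module.finrank ℚ V = Nat.totient N)
    {K : Type} [Fintype K] (p : K → H.endAlg) (t : K → (ZMod N)ˣ)
    (hp0 : ∀ k, (p k : Module.End ℚ V) ≠ 0)
    (hpt : ∀ k, (p k : Module.End ℚ V) * (a : Module.End ℚ V) =
      (a : Module.End ℚ V) ^ ((t k : ZMod N).val) * (p k : Module.End ℚ V))
    (hcover : ∀ w : (ZMod N)ˣ, (∀ u, deg (w * u) = deg u) → w = 1 ∨ ∃ k, t k = w) (g : H.endAlg) :
    (g : Module.End ℚ V) ∈ Submodule.span ℚ
      ((Set.range fun i : Fin N ↦ (a : Module.End ℚ V) ^ (i : ℕ)) ∪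
        Set.range fun ki : K × Fin N ↦ (a : Module.End ℚ V) ^ (ki.2 : ℕ) * (p ki.1 : Module.End ℚ V)) := by
  haveI : NeZero N := ⟨hN.ne'⟩
  set α : Module.End ℚ V := (a : Module.End ℚ V) with hαdef
  set Sp : Submodule ℚ (Module.End ℚ V) := Submodule.span ℚ
      ((Set.range fun i : Fin N ↦ α ^ (i : ℕ)) ∪
        Set.range fun ki : K × Fin N ↦ α ^ (ki.2 : ℕ) * (p ki.1 : Module.End ℚ V)) with hSp
  -- (A) the eigenbasis `ω`, `Φ_N(α) = 0`, `α^N = 1`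
  have hμ : Function.Injective fun u : (ZMod N)ˣ ↦ ζ ^ (u : ZMod N).val := pow_val_injective hζ
  have hev : ∀ u : (ZMod N)ˣ, Module.End.HasEigenvector (α.baseChange ℂ) (ζ ^ (u : ZMod N).val) (ω u) := fun u ↦
    ⟨Module.End.mem_eigenspace_iff.2 (heig u), hω0 u⟩
  have hli : LinearIndependent ℂ ω := Module.End.eigenvectors_linearIndependent' _ _ hμ ω hev
  have hcard : Fintype.card (ZMod N)ˣ = Module.finrank ℂ (ℂ ⊗[ℚ] V) := by
    rw [ZMod.card_units_eq_totient, Module.finrank_baseChange, hrk]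
  have hspan : Submodule.span ℂ (Set.range ω) = ⊤ := hli.span_eq_top_of_card_eq_finrank' hcard
  have hΦ : aeval α (cyclotomic N ℚ) = 0 := by
    refine eq_zero_of_baseChange_apply_eq_zero ω hspan _ fun u ↦ ?_
    rw [Motives.baseChange_aeval, Module.End.aeval_apply_of_hasEigenvector (hev u), map_cyclotomic,
      ((hζ.pow_of_coprime _ (ZMod.val_coe_unit_coprime u)).isRoot_cyclotomic hN).eq_zero, zero_smul]
  have hαN : α ^ N = 1 := by
    obtain ⟨q, hq⟩ := cyclotomic.dvd_X_pow_sub_one N ℚ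
    have h := congrArg (aeval α) hq
    rw [map_mul, hΦ, zero_mul, map_sub, map_pow, aeval_X, map_one, sub_eq_zero] at h
    exact h
  -- polynomials in `α`, and `q(α) p_k`, lie in `Sp`
  have hpow_mem : ∀ i : ℕ, α ^ i ∈ Sp := fun i ↦ by
    rw [pow_eq_pow_mod hαN i]
    exact Submodule.subset_span (Or.inl ⟨⟨i % N, Nat.mod_lt i hN⟩, rfl⟩)
  have haeval_mem : ∀ q : ℚ[X], aeval α q ∈ Sp := fun q ↦ by
    rw [aeval_eq_sum_range]
    exact Submodule.sum_mem _ fun i _ ↦ Submodule.smul_mem _ _ (hpow_mem i)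
  have hpow_mul_mem : ∀ (k : K) (i : ℕ), α ^ i * (p k : Module.End ℚ V) ∈ Sp := fun k i ↦ by
    rw [pow_eq_pow_mod hαN i]
    exact Submodule.subset_span (Or.inr ⟨(k, ⟨i % N, Nat.mod_lt i hN⟩), rfl⟩)
  have haeval_mul_mem : ∀ (q : ℚ[X]) (k : K), aeval α q * (p k : Module.End ℚ V) ∈ Sp := fun q k ↦ by
    rw [aeval_eq_sum_range, Finset.sum_mul]
    refine Submodule.sum_mem _ fun i _ ↦ ?_
    rw [smul_mul_assoc]
    exact Submodule.smul_mem _ _ (hpow_mul_mem k i)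
  -- (B) the twisted averages of `g`
  set Ψ : (ZMod N)ˣ → Module.End ℚ V := fun s ↦
    ∑ k ∈ Finset.range N, α ^ ((-(s : ZMod N) * (k : ZMod N)).val) * (g : Module.End ℚ V) * α ^ k with hΨdef
  have hΨmem : ∀ s, Ψ s ∈ H.endAlg := fun s ↦ by
    refine Subalgebra.sum_mem _ fun k _ ↦ ?_
    exact Subalgebra.mul_mem _ (Subalgebra.mul_mem _ (Subalgebra.pow_mem _ a.2 _) g.2) (Subalgebra.pow_mem _ a.2 _)
  have hΨsemi : ∀ s, SemiconjBy (Ψ s) α (α ^ (s : ZMod N).val) := fun s ↦ semiconj_twistAverage _ hαN s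
  have hΨsum : ∑ s, Ψ s = (N : ℚ) • (g : Module.End ℚ V) := sum_twistAverage _ hζ ω hspan heig
  -- (C) each `Ψ s` lies in `Sp`
  have hΨSp : ∀ s, Ψ s ∈ Sp := by
    intro s
    by_cases h0 : Ψ s = 0
    · rw [h0]; exact zero_mem _
    have hinj : Function.Injective (Ψ s) := injective_of_semiconj hN hΦ hrk (hΨsemi s) h0
    have hstab : ∀ u, deg (s * u) = deg u := fun u ↦
      deg_mul_eq_of_semiconj hN hζ deg ω hω0 hF hnF heig hrk (hΨmem s) (hΨsemi s) hinj u
    rcases hcover s hstab with rfl | ⟨k, hk⟩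
    · -- `s = 1`: `Ψ` commutes with `α`, hence is a polynomial in `α`
      have hc : SemiconjBy (Ψ 1) α α := by
        have h1 := hΨsemi 1
        rwa [Units.val_one, ZMod.val_one_eq_one_mod, ← pow_eq_pow_mod hαN, pow_one] at h1
      obtain ⟨q, hq⟩ := exists_eq_aeval_of_commute hN hΦ hrk hc
      rw [hq]
      exact haeval_mem q
    · -- `s = t k`: `Ψ = q(α) p_k`
      have hpk : SemiconjBy (p k : Module.End ℚ V) α (α ^ ((t k : (ZMod N)ˣ) : ZMod N).val) := hpt k
      have hpinj : Function.Injective (p k : Module.End ℚ V) := injective_of_semiconj hN hΦ hrk hpk (hp0 k)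
      have hs' : SemiconjBy (Ψ s) α (α ^ ((t k : (ZMod N)ˣ) : ZMod N).val) := by rw [hk]; exact hΨsemi s
      obtain ⟨q, hq⟩ := exists_eq_aeval_mul hN hΦ hαN hrk hs' hpk hpinj
      rw [hq]
      exact haeval_mul_mem q k
  -- (D) `g = N⁻¹ Σ_s Ψ s`
  have hg : (g : Module.End ℚ V) = (N : ℚ)⁻¹ • ∑ s, Ψ s := by
    rw [hΨsum, smul_smul, inv_mul_cancel₀ (Nat.cast_ne_zero.2 hN.ne'), one_smul]
  rw [hg]
  exact Submodule.smul_mem _ _ (Submodule.sum_mem _ fun s _ ↦ hΨSp s)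

end TwistSep

/-- **TWIST-SEP-1 holds** (kernel; cell hodge-nonav P1 g32). -/
theorem twistSepEndSpan_holds : TwistSepEndSpan := by
  intro V _ _ _ n H a N hN ζ hζ deg ω hω0 hF hnF heig hrk K _ p t hp0 hpt hcover g
  exact TwistSep.coe_endAlg_mem_span_of_twists a hN hζ deg ω hω0 hF hnF heig hrk p t hp0 hpt hcover g

end TwistSepProof

end Summit.HodgeConjecture.HodgeConjecture.Theorems.TwistedCyclotomicSelfMapSquareHodge

end
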